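import Summits.RiemannHypothesis.RiemannHypothesis.Theses.LaguerreSpeiserSplit
import Summits.RiemannHypothesis.RiemannHypothesis.Theorems.Splittings.JensenX4CleanSplit
import HarnessLib

/-!
# Route LaguerreSpeiserSplit (S12) — the honest ALTERNATIVE CLOSERS «CLEAN NEAR FIELD» / «JENSEN SHADOW»

The deciding theorems of the D-0146 map's sufficient route S12 in the two shapes the lines of record L38
«CLEAN NEAR FIELD» (rh-idea-2 g2, item 23196 `LaguerreSignAtCriticalPoints` = C′) and L40 «JENSEN SHADOW»
(items 23309 `JensenShadowFree`, 23303 `DipInJensenDisc` — CLOSED, prover-l38 g0,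
`Theorems.dipInJensenDisc`) put on the route, written over the ROUTE DECLS by name
(route file re-render a9def53fb9fceda9) and the tree kernels `JensenX4CleanSplit.rh_iff_xiPrimeOnLine_and_laguerreAtCriticalPoints`
(RH ⟺ XiPrimeOnLine ∧ C′), `JensenX4HereditaryLaguerreRH.xiPrimeOnLine_of_rh`,
`riemannHypothesis_iff_im_eq_zero_of_riemannXiUpper_eq_zero_holds` (RH ⟺ Ξ has only real zeros):

* `rh_of_xiPrime_of_laguerreSign : XiPrimeOnLine → LaguerreSignAtCriticalPoints → RH` — the `closes'` shape
  (gate5 ASK #6 amended; the route-level registration is the gate's / director's edit, not this file's);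
* `laguerreSign_of_dip_of_shadowFree : DipInJensenDisc → JensenShadowFree → LaguerreSignAtCriticalPoints` — the
  L40 composition (a wrong-sign dip is shadowed by an off-line zero, contradicting shadow-freeness), and, 23303
  being a tree theorem, `laguerreSign_of_shadowFree : JensenShadowFree → LaguerreSignAtCriticalPoints` outright;
* `jensenShadowFree_of_rh`, `rh_of_xiPrime_of_shadowFree`, and the census rows
  `rh_iff_xiPrime_and_shadowFree (hL : DipInJensenDisc) : RH ↔ XiPrimeOnLine ∧ JensenShadowFree` and its
  unconditional form `rh_iff_xiPrime_and_shadowFree'`.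

Port of rh-idea-2 g2's kernel-checked sketch `pub/ideators/rh-idea-2/LINE-L40-jensen-shadow.lean` (sha16
b595362085527525, ll. 111–160) with the sketch's local defs replaced by the route decls and its `stub_dipInJensenDisc`
by the landed theorem; filed by rh-split-typer-5 under lead g9 RULINGS #352 (a)(1) / #360, `--supports 23309`.
CONDITIONAL bookkeeping: `XiPrimeOnLine` (item 18896) and `JensenShadowFree` (item 23309) are OPEN, RH-implied
conjectures; RH is not proved by this; nothing here bears on the truth of RH.  No `sorry`, no definitions.
-/

-- D-0017: `Summit.RiemannHypothesis.RiemannHypothesis.…` duplicates the namespace BY DESIGN (single-problem summit).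
set_option linter.dupNamespace false

namespace Summit.RiemannHypothesis.RiemannHypothesis.Theorems.LaguerreSpeiserSplitAltClosers

open Literature.NumberTheory.LFunctions
open Summit.RiemannHypothesis.RiemannHypothesis.Theses.LaguerreSpeiserSplit
  (XiPrimeOnLine LaguerreSignAtCriticalPoints JensenShadowFree DipInJensenDisc)
open Summit.RiemannHypothesis.RiemannHypothesis.Theorems.Splittings

/-! ## 1. The `closes'` shape: `XiPrimeOnLine → C′ → RH` -/

/-- **ALT-CLOSER of S12 («clean near field», L38): `XiPrimeOnLine → LaguerreSignAtCriticalPoints → RH`.**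
The route's C′ (item 23196) is literally the Laguerre-sign clause of
`JensenX4CleanSplit.rh_iff_xiPrimeOnLine_and_laguerreAtCriticalPoints`. -/
theorem rh_of_xiPrime_of_laguerreSign (hA : XiPrimeOnLine) (hC : LaguerreSignAtCriticalPoints) :
    _root_.Summit.RiemannHypothesis :=
  JensenX4CleanSplit.rh_iff_xiPrimeOnLine_and_laguerreAtCriticalPoints.mpr ⟨hA, hC⟩

/-- Converse bookkeeping: RH gives both hypotheses of the `closes'` shape. -/
theorem xiPrime_and_laguerreSign_of_rh (h : _root_.Summit.RiemannHypothesis) :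
    XiPrimeOnLine ∧ LaguerreSignAtCriticalPoints :=
  JensenX4CleanSplit.rh_iff_xiPrimeOnLine_and_laguerreAtCriticalPoints.mp h

/-! ## 2. The Jensen-shadow composition (L40) -/

/-- **L40 composition: `DipInJensenDisc → JensenShadowFree → LaguerreSignAtCriticalPoints`.**  At a critical
point `c` of `Re Ξ` with `Ξ(c) ≠ 0` and the wrong sign `Re Ξ(c)·(Re Ξ)″(c) ≥ 0`, item 23303 puts `c` in the
closed Jensen disc of some off-line zero `ρ` (`|c − Re ρ| ≤ |Im ρ|`), while shadow-freeness (item 23309) says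
`|Im ρ| < |c − Re ρ|` — contradiction. (rh-idea-2's `laguerreSign_of_parts`.) -/
theorem laguerreSign_of_dip_of_shadowFree (hL : DipInJensenDisc) (hJ : JensenShadowFree) :
    LaguerreSignAtCriticalPoints := by
  intro c hc1 hc0
  by_contra hge
  push Not at hge
  obtain ⟨ρ, hρ0, hρim, hdisc⟩ := hL c hc1 hc0 hge
  exact absurd (lt_of_lt_of_le (hJ ρ hρ0 hρim c hc1 hc0) hdisc) (lt_irrefl _)

/-- **`JensenShadowFree → LaguerreSignAtCriticalPoints` UNCONDITIONALLY** — item 23303 `DipInJensenDisc` is the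
tree theorem `Theorems.dipInJensenDisc` (prover-l38 g0), so the L40 composition needs only the
(a)-piece. -/
theorem laguerreSign_of_shadowFree (hJ : JensenShadowFree) : LaguerreSignAtCriticalPoints :=
  laguerreSign_of_dip_of_shadowFree
    Summit.RiemannHypothesis.RiemannHypothesis.Theorems.dipInJensenDisc hJ

/-- **(a)-certificate: RH ⟹ `JensenShadowFree`** (under RH `Ξ` has no off-line zero at all —
`riemannHypothesis_iff_im_eq_zero_of_riemannXiUpper_eq_zero_holds`). -/
theorem jensenShadowFree_of_rh (h : _root_.Summit.RiemannHypothesis) : JensenShadowFree := by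
  intro ρ hρ0 hρim
  exact absurd ((riemannHypothesis_iff_im_eq_zero_of_riemannXiUpper_eq_zero_holds.mp h) ρ hρ0) hρim

/-- **SEAM in Jensen-shadow form: `DipInJensenDisc → XiPrimeOnLine → JensenShadowFree → RH`.** -/
theorem rh_of_xiPrime_of_shadowFree (hL : DipInJensenDisc) (hA : XiPrimeOnLine) (hJ : JensenShadowFree) :
    _root_.Summit.RiemannHypothesis :=
  rh_of_xiPrime_of_laguerreSign hA (laguerreSign_of_dip_of_shadowFree hL hJ)

/-! ## 3. The census rows -/

/-- **CENSUS ROW modulo the RH-free lemma: `DipInJensenDisc → (RH ↔ XiPrimeOnLine ∧ JensenShadowFree)`.**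
Both conjuncts are OPEN, RH-implied (`xiPrimeOnLine_of_rh`, `jensenShadowFree_of_rh`). -/
theorem rh_iff_xiPrime_and_shadowFree (hL : DipInJensenDisc) :
    _root_.Summit.RiemannHypothesis ↔ (XiPrimeOnLine ∧ JensenShadowFree) :=
  ⟨fun h ↦ ⟨JensenX4HereditaryLaguerreRH.xiPrimeOnLine_of_rh h, jensenShadowFree_of_rh h⟩,
    fun h ↦ rh_of_xiPrime_of_shadowFree hL h.1 h.2⟩

/-- **ALT-CLOSER of S12 in Jensen-shadow form, UNCONDITIONAL kernel: `RH ↔ XiPrimeOnLine ∧ JensenShadowFree`**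
(item 23303 discharged by the tree theorem `Theorems.dipInJensenDisc`). -/
theorem rh_iff_xiPrime_and_shadowFree' :
    _root_.Summit.RiemannHypothesis ↔ (XiPrimeOnLine ∧ JensenShadowFree) :=
  rh_iff_xiPrime_and_shadowFree
    Summit.RiemannHypothesis.RiemannHypothesis.Theorems.dipInJensenDisc

end Summit.RiemannHypothesis.RiemannHypothesis.Theorems.LaguerreSpeiserSplitAltClosers
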